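import Literature.MathematicalPhysics.QuantumFieldTheory.Balaban1983to89.Node00.HistoryTermDatum214WindowDilated

/-!
# BalabanUVNodes ∕ node N22 = NE9 — RIGIDITY OF A COUPLING-FROZEN BOX DICTIONARY AGAINST def-W1's UNSCALED-FIELD LAW (A6 note, g20): on any coupling domain that contains the
# real window, «the characteristic functions do not move with the complex coupling» + «the boxes read the unscaled field `g_k·B′` at every real coupling» force COUPLING-BLIND
# unscaled boxes — print's `Π χ({|B′(b)| < ε₁})` is not

Cell `pub-ymgap`, HUMAN RULING D-0062 (Track A), R134 seat `pub-ymgap-dag-n22-c` (strategy s1: «the history-Lipschitz estimate (2.40)–(2.41) p. 21 of [II] on the W1 object»), generation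
20, module J80A.  THEOREMS ONLY (no `def`, no `sorry`, standard axioms); `--kind proof --supports stmt-QuantumFields-27366 --as helper` (K3⁸ `SpineGivenEndpointR13SepCoPHV`), COUNT-NEUTRAL.
Imports def-W1's `Node00/HistoryTermDatum214WindowDilated` only (`TermDatum214.UnscaledFieldLawOn` and its projections `chiY₀_eq ∕ chicP_eq`).  A LOCATED consistency note in the
style of module J75 (`isEmpty_params_of_mapsToTables_emptyTable`) and module 26′ (`thresholdLaw_frozen_of_lastDiscs`, `not_lastDiscs_invNorm`): three rewrites, no estimate.

WHY.  Every N22 bill at def-W1's (2.14) term data (modules J68–J79, J81) carries the UNSCALED-FIELD LAW `hlaw : (𝔇 K).UnscaledFieldLawOn (χu K) (χcu K) (𝒲 K) (𝒪 K) θ.γ` ([I] p. 267 «we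
make the scaling transformation B = g_kB′»): at every REAL window coupling `s ∈ ]0, γ]` the small-field boxes and the large-field function READ THE UNSCALED FIELD AT `s·B`,
`𝔇.chiY₀ Z t ↑s B = χu Z t (s • B)`, `𝔇.chicP Z t ↑s B = χcu Z t (s • B)` — the thresholds MOVE with the coupling.  A per-term COUPLING DICTIONARY of the shape «one base coupling `s₀`
and `∀ z ∈ O, chiY₀ Z t z = chiY₀ Z t s₀ ∧ chicP Z t z = chicP Z t s₀`» (node N10's module 111 `termCouplingSectors_of_inputs226Holo_dictionary`, binder `hιO`, generic in the open
sets `O K`) FREEZES them on `O`.  N22's last-coupling SECTOR clause puts every real window coupling inside the domain: `closedBall ↑t (c_S·t) ⊆ O K` for `t ∈ ]0, γ]` (`hballS` of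
J58–J81), so `↑t ∈ O K`.  The conjunction is consistent ONLY with coupling-blind unscaled boxes: `χu Z t (r • B) = χu Z t (r′ • B)` for all `r, r′ ∈ ]0, γ]` and every `B` (§1–§2);
print's box `Π_b χ({|B′(b)| < ε₁})` read at `r • B′` is NOT coupling-blind as soon as the bond set is inhabited (§3: `B′ ≡ ε₁∕γ` is inside the box at `r = γ∕2` and outside at
`r = γ`), so under it the conjunction is `False` (§3 `false_of_frozenChi_law_of_genuineBox`).  CONSEQUENCE for this lane: the module-111 plugs of the sockets J79 ∕ J81 (drafts J80 ∕
J82 of this generation) are NOT filed; the per-term last-coupling letters of N22's bills are re-keyed on a CONTINUED term family `Tc` agreeing with the datum's display at real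
couplings (module J81; def-W1's designated continuation `TermData214.continuedTF`, same W1 file §4–§6, whose boxes stay at the base point while the DILATION parameter moves) — the
window-dilated road of [I] p. 267, not a frozen-threshold reading of [II] (2.3).
* §1 `chiU_couplingBlind_of_frozenChi_law`, `chicU_couplingBlind_of_frozenChic_law` (one datum, one term: law + frozen dictionary on `O ∋ ↑t` for all `t ∈ ]0,γ]` ⟹ coupling-blind).
* §2 `ofReal_mem_of_sectorDiscs` (the sector clause puts the real window inside `O`); `chiU_couplingBlind_of_couplingDictionary` (family level, module 111's binder shape projected to
  its χ-conjunct, generic class `Adm` and tables `spX`, at any inhabited slice).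
* §3 `printedBox_not_couplingBlind` (Mathlib only: the indicator of `{∀ b, |B′ b| < ε₁}` read at `r • B′` distinguishes `r = γ∕2` from `r = γ` on an inhabited bond set);
  `false_of_frozenChi_law_of_genuineBox` (law + frozen dictionary + real window inside `O` + ONE coupling-sensitive box value ⟹ `False`).

HONEST FRAMING (binding).  Elementary rewrites; an A6-class CONSISTENCY note about DISPLAYED hypothesis shapes (def-W1's law schema × a coupling-frozen dictionary × N22's sector
clause) — it says which conjunctions only degenerate data inhabit; it proves NO estimate of Bałaban's and asserts nothing about the datum of record; node N10's modules 110∕111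
remain TRUE implications (their dictionary is displayed, generic in `O`).  N22 ∕ N10 NOT discharged (7∕27 per dag-lead TABLE, unchanged); K3⁸ OPEN and NOT claimed; one finite 𝕋⁴
programme at fixed ε — NOTHING about the continuum limit, ℝ⁴, OS axioms, a mass gap or the Clay problem is proved or claimed.  References (TYPES only): [I] = Bałaban, CMP 109
(1987) (2.9) p. 266, p. 267 («B = g_kB′»), (2.12)–(2.13) p. 268, §1 p. 263; [II] = CMP 116 (1988) (2.3) p. 12, (2.14) p. 15.
-/

noncomputable section

open Set Metric

namespace YMDAG.N22.TermRecursion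

open Literature.MathematicalPhysics.QuantumFieldTheory.Balaban1983to89
open Literature.MathematicalPhysics.QuantumFieldTheory.Balaban1983to89.B13Lemma3TorusTerms (terms)
open Literature.MathematicalPhysics.QuantumFieldTheory.Balaban1983to89.Node00.Sect2 (domSys domCount CPair)
open Literature.MathematicalPhysics.QuantumFieldTheory.Balaban1983to89.Node00.W1

/-! ## §1 One datum, one term: the law and a coupling-frozen box dictionary force coupling-blind unscaled boxes -/

section OneDatum

variable {c : B13.Consts} {P : Params} {𝔸 : Type*} {M k L : ℕ} [NeZero L] (𝔇 : TermDatum214 c P 𝔸 M k L)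
  {χu χcu : 𝔇.UnscaledChi} {𝒲 : 𝔇.UnscaledWilson} {𝒪 : 𝔇.UnscaledOlder}

/-- **COUPLING-BLIND SMALL-FIELD BOXES.**  If the datum obeys the unscaled-field law on the window `]0, γ]` (`chiY₀ Z t ↑r B = χu Z t (r • B)`), the domain `O` contains every real
window coupling, and the small-field box of the term `(Z, t)` is FROZEN on `O` (`chiY₀ Z t z = chiY₀ Z t s₀` for `z ∈ O`), then the unscaled box does not see the coupling:
`χu Z t (r • B) = χu Z t (r′ • B)` for all `r, r′ ∈ ]0, γ]`, every `B`. [cite: Balaban1987RG1, (2.9) p.266 and p.267; Balaban1988RG2Cluster, (2.3) p.12] -/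
theorem chiU_couplingBlind_of_frozenChi_law {γ : ℝ} (hlaw : 𝔇.UnscaledFieldLawOn χu χcu 𝒲 𝒪 γ) {O : Set ℂ} (hO : ∀ r ∈ Ioc (0 : ℝ) γ, ((r : ℝ) : ℂ) ∈ O)
    (Z : (domSys P M (k + 1)).Dom) (t : TermLabel P M k L) {s₀ : ℂ} (hχ : ∀ z ∈ O, 𝔇.chiY₀ Z t z = 𝔇.chiY₀ Z t s₀) :
    ∀ r ∈ Ioc (0 : ℝ) γ, ∀ r' ∈ Ioc (0 : ℝ) γ, ∀ B : (𝔇.𝒦 Z t).Λ → ℝ, χu Z t (r • B) = χu Z t (r' • B) := by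
  intro r hr r' hr' B
  rw [← hlaw.chiY₀_eq 𝔇 Z t hr B, ← hlaw.chiY₀_eq 𝔇 Z t hr' B, congrFun (hχ _ (hO r hr)) B, congrFun (hχ _ (hO r' hr')) B]

/-- **COUPLING-BLIND LARGE-FIELD FUNCTIONS** — the same for `chicP ∕ χcu`. [cite: Balaban1987RG1, (2.9) p.266 and p.267; Balaban1988RG2Cluster, (2.3) p.12] -/
theorem chicU_couplingBlind_of_frozenChic_law {γ : ℝ} (hlaw : 𝔇.UnscaledFieldLawOn χu χcu 𝒲 𝒪 γ) {O : Set ℂ} (hO : ∀ r ∈ Ioc (0 : ℝ) γ, ((r : ℝ) : ℂ) ∈ O)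
    (Z : (domSys P M (k + 1)).Dom) (t : TermLabel P M k L) {s₀ : ℂ} (hχ : ∀ z ∈ O, 𝔇.chicP Z t z = 𝔇.chicP Z t s₀) :
    ∀ r ∈ Ioc (0 : ℝ) γ, ∀ r' ∈ Ioc (0 : ℝ) γ, ∀ B : (𝔇.𝒦 Z t).Λ → ℝ, χcu Z t (r • B) = χcu Z t (r' • B) := by
  intro r hr r' hr' B
  rw [← hlaw.chicP_eq 𝔇 Z t hr B, ← hlaw.chicP_eq 𝔇 Z t hr' B, congrFun (hχ _ (hO r hr)) B, congrFun (hχ _ (hO r' hr')) B]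

end OneDatum

/-! ## §2 The sector clause puts the real window inside the domain; the family-level corollary in module 111's binder shape -/

/-- The N22 sector clause `closedBall ↑t (c_S·t) ⊆ O` (`t ∈ ]0, γ]`, `0 ≤ c_S`) puts every real window coupling inside `O`. [folklore] -/
theorem ofReal_mem_of_sectorDiscs {γ cS : ℝ} (hcS : 0 ≤ cS) {O : Set ℂ} (hball : ∀ s ∈ Ioc (0 : ℝ) γ, closedBall (s : ℂ) (cS * s) ⊆ O) :
    ∀ r ∈ Ioc (0 : ℝ) γ, ((r : ℝ) : ℂ) ∈ O :=
  fun r hr => hball r hr (mem_closedBall_self (mul_nonneg hcS hr.1.le))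

section Family

variable (F : T4Continuum.T4Family) {M : ℕ} [NeZero M] (L : ℕ) [NeZero L] {𝔸 : Type} {c₀ : B13.Consts} (𝔇 : (K : ℕ) → TermData214 c₀ (F.P K) 𝔸 M L)
  (spX : (K k : ℕ) → (domSys (F.P K) M (k + 1)).Dom → Set (CPair (F.P K) 𝔸)) (Adm : (K k : ℕ) → OlderTerms (F.P K) 𝔸 M k → Prop) (O : ℕ → Set ℂ)

/-- **FAMILY LEVEL (module 111's `hιO` projected to its box conjunct).**  Under the family law `(𝔇 K).UnscaledFieldLawOn …  γ`, the real window inside `O K`, and a per-term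
dictionary «`∃ s₀, ∀ z ∈ O K, (𝔇 K k).chiY₀ Z s z = (𝔇 K k).chiY₀ Z s s₀`» on the class `Adm K k` and the tables `spX K k X` (polymers `Z ⊆ X`, labels `s ∈ terms L M Z`): at
every INHABITED slice (`Adm K k old₀`, `φ₀ ∈ spX K k X`) every term's unscaled box is coupling-blind on `]0, γ]`.
[cite: Balaban1987RG1, (2.9) p.266 and p.267; Balaban1988RG2Cluster, (2.3) p.12 and (2.14) p.15] -/
theorem chiU_couplingBlind_of_couplingDictionary {γ : ℝ}
    {χu χcu : (K k : ℕ) → (𝔇 K k).UnscaledChi} {𝒲 : (K k : ℕ) → (𝔇 K k).UnscaledWilson} {𝒪 : (K k : ℕ) → (𝔇 K k).UnscaledOlder}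
    (hlaw : ∀ K, (𝔇 K).UnscaledFieldLawOn (χu K) (χcu K) (𝒲 K) (𝒪 K) γ) (hO : ∀ K, ∀ r ∈ Ioc (0 : ℝ) γ, ((r : ℝ) : ℂ) ∈ O K)
    (hιO : ∀ (K k : ℕ) (old : OlderTerms (F.P K) 𝔸 M k), Adm K k old → ∀ (X : (domSys (F.P K) M (k + 1)).Dom), ∀ φ ∈ spX K k X,
      ∀ Z : (domSys (F.P K) M (k + 1)).Dom, Subtype.val Z ⊆ Subtype.val X → ∀ s ∈ terms L M Z,
        ∃ s₀ : ℂ, ∀ z ∈ O K, (𝔇 K k).chiY₀ Z s z = (𝔇 K k).chiY₀ Z s s₀)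
    (K k : ℕ) {old₀ : OlderTerms (F.P K) 𝔸 M k} (hold₀ : Adm K k old₀) (X : (domSys (F.P K) M (k + 1)).Dom) {φ₀ : CPair (F.P K) 𝔸} (hφ₀ : φ₀ ∈ spX K k X) :
    ∀ Z : (domSys (F.P K) M (k + 1)).Dom, Subtype.val Z ⊆ Subtype.val X → ∀ s ∈ terms L M Z,
      ∀ r ∈ Ioc (0 : ℝ) γ, ∀ r' ∈ Ioc (0 : ℝ) γ, ∀ B : ((𝔇 K k).𝒦 Z s).Λ → ℝ, χu K k Z s (r • B) = χu K k Z s (r' • B) := by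
  intro Z hZ s hs
  obtain ⟨s₀, hχ⟩ := hιO K k old₀ hold₀ X φ₀ hφ₀ Z hZ s hs
  exact chiU_couplingBlind_of_frozenChi_law (𝔇 K k) (hlaw K k) (hO K) Z s hχ

end Family

/-! ## §3 Print's box is not coupling-blind; the conjunction is `False` under one coupling-sensitive box value -/

open Classical in
/-- **PRINT's SMALL-FIELD BOX READ AT `r • B′` SEES THE COUPLING.**  On an inhabited bond set, the indicator of `{∀ b, |B′(b)| < ε₁}` ([I] (2.9) `Π χ({|B′(b)| < ε₁})`) read at the
unscaled field `r • B′` takes different values at `r = γ∕2` and `r = γ` for `B′ ≡ ε₁∕γ` (`ε₁, γ > 0`). [cite: Balaban1987RG1, (2.9) p.266 and p.267] -/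
theorem printedBox_not_couplingBlind {Λ : Type*} [Nonempty Λ] {ε₁ γ : ℝ} (hε : 0 < ε₁) (hγ : 0 < γ) :
    ∃ B : Λ → ℝ, ∃ r ∈ Ioc (0 : ℝ) γ, ∃ r' ∈ Ioc (0 : ℝ) γ,
      (if ∀ b, |(r • B) b| < ε₁ then (1 : ℝ) else 0) ≠ (if ∀ b, |(r' • B) b| < ε₁ then (1 : ℝ) else 0) := by
  obtain ⟨b₀⟩ := ‹Nonempty Λ›
  refine ⟨fun _ => ε₁ / γ, γ / 2, ⟨by linarith, by linarith⟩, γ, ⟨hγ, le_rfl⟩, ?_⟩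
  have h1 : ∀ b : Λ, |((γ / 2) • fun _ : Λ => ε₁ / γ) b| < ε₁ := fun b => by
    rw [Pi.smul_apply, smul_eq_mul, show γ / 2 * (ε₁ / γ) = ε₁ / 2 by field_simp, abs_of_pos (by linarith)]
    linarith
  have h2 : ¬ ∀ b : Λ, |(γ • fun _ : Λ => ε₁ / γ) b| < ε₁ := fun h => by
    have hb := h b₀
    rw [Pi.smul_apply, smul_eq_mul, show γ * (ε₁ / γ) = ε₁ by field_simp, abs_of_pos hε] at hb
    exact lt_irrefl _ hb
  rw [if_pos h1, if_neg h2]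
  exact one_ne_zero

section OneDatum'

variable {c : B13.Consts} {P : Params} {𝔸 : Type*} {M k L : ℕ} [NeZero L] (𝔇 : TermDatum214 c P 𝔸 M k L)
  {χu χcu : 𝔇.UnscaledChi} {𝒲 : 𝔇.UnscaledWilson} {𝒪 : 𝔇.UnscaledOlder}

/-- **THE CONJUNCTION IS `False` UNDER ONE COUPLING-SENSITIVE BOX VALUE**: unscaled-field law on `]0, γ]` + box frozen on `O` + real window inside `O` + one bond field `B` and two
window couplings `r, r′` at which the unscaled box differs ⟹ `False` (§1). [cite: Balaban1987RG1, (2.9) p.266 and p.267; Balaban1988RG2Cluster, (2.3) p.12] -/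
theorem false_of_frozenChi_law_of_genuineBox {γ : ℝ} (hlaw : 𝔇.UnscaledFieldLawOn χu χcu 𝒲 𝒪 γ) {O : Set ℂ} (hO : ∀ r ∈ Ioc (0 : ℝ) γ, ((r : ℝ) : ℂ) ∈ O)
    (Z : (domSys P M (k + 1)).Dom) (t : TermLabel P M k L) {s₀ : ℂ} (hχ : ∀ z ∈ O, 𝔇.chiY₀ Z t z = 𝔇.chiY₀ Z t s₀)
    (hbox : ∃ B : (𝔇.𝒦 Z t).Λ → ℝ, ∃ r ∈ Ioc (0 : ℝ) γ, ∃ r' ∈ Ioc (0 : ℝ) γ, χu Z t (r • B) ≠ χu Z t (r' • B)) : False := by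
  obtain ⟨B, r, hr, r', hr', hne⟩ := hbox
  exact hne (chiU_couplingBlind_of_frozenChi_law 𝔇 hlaw hO Z t hχ r hr r' hr' B)

end OneDatum'

end YMDAG.N22.TermRecursion

end
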